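import Summits.QuantumFields.BalabanUV.T4Continuum.Support.B13StepOfRecordSecantEnd
import Summits.QuantumFields.BalabanUV.T4Continuum.Support.B13StepEndInsOp
import Summits.QuantumFields.BalabanUV.T4Continuum.Support.UrsellOfRecordFaces
import Summits.QuantumFields.BalabanUV.T4Continuum.Support.B13StepOfRecordReadAt

/-!
# NE5 ∕ U3 — the SECANT END FACE ON BAŁABAN's CARRIERS OF RECORD IN PRINTED-SHAPE CURRENCIES: W4 PRODUCED from the
# insertion-operator species (leaf-10's `B13StepEndInsOp.insertionRate_of_insOp`), the anchored norm PRODUCED from the (2.38) SHAPE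
# (leaf-02's `UrsellOfRecordFaces.anchoredNorm_b13`, (1.26)∕(2.30) the TR theorems), the READING by construction (leaf-03's
# `B13StepOfRecordReadAt`) — composed with `B13StepOfRecordSecantEnd` (E8[rec])

Cell `pub-balaban`, unit `b2b-balaban-t4-ne5-formalise-leaf-01` (NE5 formalisation swarm, LEAF PROVER 01, gen 4; journal INTENT
`B13StepOfRecordSecantShapes`; a FOLLOWER of this lineage's `Support/B13StepOfRecordSecantEnd` p211635).  Summits-side NEW WORK under
the LEAN PLACEMENT RULE (cell bookkeeping; NOT a Literature module; NO owner END-face module is edited — a NEW module composing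
LANDED theorems BY NAME, as leaf-10's `B13StepEndInsOp` p209302 does for the termwise END and leaf-08's `UrsellOfRecord` p210518 for
the class bound).  HONEST FRAMING: rung (B)+1 of the FINITE-VOLUME T⁴ continuum programme — NOT infinite volume, NOT a mass gap, NOT
the Clay problem, and **NOT A PROOF OF NE5**: the END below is an IMPLICATION whose wall binders (W2-op = `OpLipschitz`, cell GAPS
G-ne5p1-1′, NOT PRINTED; the one-run slice budgets — W3 KIND, wall O3; the insertion-operator species' one-run envelope ∕ bound —
W2-ins KIND — and two-run rate — NE2-TYPE, NOT PRINTED; W1 in row NE2's entry currency; the per-activity STRUCTURE ∕ exponent bounds ∕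
absolute majorants of the (2.14)-terms with their decay split — (2.14)∕(2.15), (2.18)∕(2.20) KIND; the (2.38) SHAPE of the stripped
majorant — [Balaban1988RG2Cluster] Lemma 3 (2.38) p. 20, locator only; the one-run levels L05∕L06 — quoted SHAPES of [Balaban1987RG1]
(1.18) p. 263; the transport reading; radii; numerics) are DISPLAYED HYPOTHESES, asserted nowhere.  HONEST DEPENDENCY (cell line,
verbatim): continuum YM on T⁴ ⇐ BetaPertH ∧ nine spine estimates (0/9 proved); BetaPertH ⇐ (D1) ∧ (D4) ∧ CAP+tail; G-an2-4 gates
asym, D1 and NE2/3/4.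

WHAT THIS FILE DOES.  On the MODEL OF RECORD `B13StepOfRecord.step S E₀ cB` (leaf-09, p208933):
* §1 **`ne5_of_record_secant_shapes`** — `B13StepOfRecordSecantEnd.ne5_of_record_secant_actNormDecay` (p211635 §2) with TWO of its
  displayed binders PRODUCED BY NAME from data closer to print:
  (i) W4 `hins : (step S E₀ cB).InsertionRate W κ E₀ δ′ θ` ⟸ the insertion-operator species of row O1-c's datum read through
  `S.D.toInsOpModel (step S E₀ cB) rI hrI` (reading `ReadsIns` BY CONSTRUCTION, leaf-09's `Assembly.readsIns`): one-run envelope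
  `InsOpEnvelope κ E₀ Gi` ∧ bound `InsBoundA κ E₀ Gi`, two-run rate `InsOpRate δI θ`, reach `δI·θ^{k₁} ≤ ρ₁ < 1`, with
  `δ′ := Gi·δI∕(1 − ρ₁) + 2Gi∕θ^{k₁}` — leaf-10's `B13StepEndInsOp.insertionRate_of_insOp`;
  (ii) the anchored exponential norm `Φ′` of the STRIPPED majorant `A′` over every catalogue `R.domAt k` ⟸ the (2.38) SHAPE
  `actSum (b13InnerData R) (A′ k g U) k Z ≤ ε·e^{−Rt·d(Z)}` on `R.domAt k` + the rate room `64·log 162 + 64 ≤ Rt`, giving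
  `Φ′ = Φ₀ := ε·e^{64}·K₀(64,8)` — leaf-02's `UrsellOfRecordFaces.anchoredNorm_b13` ((1.26)∕(2.30) = `B13DomainGeometryTR.ineq126_level` ∕
  `volBound_level`, THEOREMS on the carriers of record); so `G₁ := N̄·Φ₀∕(1 − 36Φ₀)²` and the smallness reads `36·Φ₀ < 1`.
  Conclusion LITERALLY `NE5 (B13StepOfRecord.outA S E₀ cB) (B13StepOfRecord.outB S E₀ cB) W κ θ′ C₅`.
* §2 **`exists_ne5_of_record_secant_shapes`** — the same with leaf L10's letters `k₀`, `B` ELIMINATED (`0 < θ < 1`, `0 < ρ₀`;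
  leaf-10's `OutputRateArithmetic.reach_scale_exists` ∕ `OutputRateResidual.first_scales_const`; `E₁ := 1`): `∃ C₅, NE5 … θ′ C₅`.
  (`k₁`, `ρ₁` stay displayed: the secant route's history radius `δ′·rHist + EA₀·rHist·cA∕(1−ω) ≤ RHist` names `δ′`; the η-UNIFORM
  form `∃ C₅, ∀ R S W …` is row O6-n's secant arithmetic follower, not here.)
* §3 **`ne5_of_record_secant_shapes_readAt`** ∕ **`exists_ne5_of_record_secant_shapes_readAt`** — §1∕§2 for the slot package READ AT
  THE TRANSPORTED BACKGROUND `B13StepOfRecordReadAt.readAtSlots S ι` (leaf-03-g3, p212254): the transport READING `hT` is GONE —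
  `transportReads_record_readAt S ι W` BY NAME (no hypothesis; by `transportReads_iff_exists_readAt` nothing is lost on the window).
CENSUS VALUE: E8 on the carriers of record now displays, binder for binder, the same reduction level as E1[rec] after
`B13StepEndInsOp` + `UrsellOfRecord` + `B13StepOfRecordReadAt`: W3 slice budgets ×2 · L05∕L06 · W1 entry data · insertion species (one-run W2-ins KIND +
NE2-TYPE rate + reach) · `OpLipschitz` · structure `ActExpLinearOn` · `0 ≤ N ≤ N̄` · majorant `A` with decay split against `A′` · the
(2.38) SHAPE of `A′` with two explicit inequalities · radii · signs · numerics.  Nothing is asserted about [II]'s kernels ∕ potentials ∕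
terms (the `Slots` stay PARAMETERS); 0 sorry; axioms ⊆ {propext, Classical.choice, Quot.sound}.
-/

noncomputable section

open scoped BigOperators
open Metric Set

namespace Summit.QuantumFields.BalabanUV.T4Continuum.B13StepOfRecordSecantShapes

open Literature.MathematicalPhysics.QuantumFieldTheory.Balaban1983to89
open Literature.MathematicalPhysics.QuantumFieldTheory.Balaban1983to89.T4OutputRate (DecayBound NE5)
open Literature.MathematicalPhysics.QuantumFieldTheory.Balaban1983to89.T4InputCauchyRateSpecies (ballClass OpLipschitz)
open Summit.QuantumFields.BalabanUV.T4Continuum.B13Carriers (TwoRuns)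
open Summit.QuantumFields.BalabanUV.T4Continuum.B13OpDatum (OpDatum)
open Summit.QuantumFields.BalabanUV.T4Continuum.B13OpDatumJunctions (RawBounded WeightedEntrywiseRate)
open Summit.QuantumFields.BalabanUV.T4Continuum.B13StepTermLabels (InnerLabel)
open Summit.QuantumFields.BalabanUV.T4Continuum.B13StepTermFamily (ActData ActExpLinearOn)
open Summit.QuantumFields.BalabanUV.T4Continuum.B13StepTermSocket (labelsIndexing touchInc)
open Summit.QuantumFields.BalabanUV.T4Continuum.B13InnerData (Bnd b13InnerData)
open Summit.QuantumFields.BalabanUV.T4Continuum.B13Base (selfCtr)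
open Summit.QuantumFields.BalabanUV.T4Continuum.B13Represents (Assembly)
open Summit.QuantumFields.BalabanUV.T4Continuum.B13TermHistSecant (ActExpNormBound ActAbsBound)
open Summit.QuantumFields.BalabanUV.T4Continuum.B13DomainGeometryTR (domainGeometry)
open Summit.QuantumFields.BalabanUV.T4Continuum.B13StepOfRecord (Slots assembly step outA outB)
open Summit.QuantumFields.BalabanUV.T4Continuum.UrsellTermBudget (actSum)
open Summit.QuantumFields.BalabanUV.T4Continuum.UrsellOfRecordFaces (anchoredNorm_b13 phi_nonneg)
open Summit.QuantumFields.BalabanUV.T4Continuum.B13StepEndInsOp (insertionRate_of_insOp deltaIns_nonneg)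
open Summit.QuantumFields.BalabanUV.T4Continuum.B13StepOfRecordSecantEnd (ne5_of_record_secant_actNormDecay)
open Summit.QuantumFields.BalabanUV.T4Continuum.B13StepOfRecordReadAt (readAtSlots transportReads_record_readAt)

variable {G : Type} [GaugeGroup G] {R : TwoRuns G} {E IOp Hist Ω : Type*} [NormedAddCommGroup Hist] [NormedSpace ℂ Hist]
  [CompleteSpace Hist] [NormedAddCommGroup IOp] [NormedSpace ℂ IOp] [MeasurableSpace Ω] (S : Slots R E IOp Hist) (E₀ cB : ℝ)

/-! ## §1 The secant END face on the carriers of record, W4 and the anchored norm PRODUCED -/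

/-- [folklore] **THE SECANT END FACE ON BAŁABAN's CARRIERS OF RECORD IN PRINTED-SHAPE CURRENCIES.**
`B13StepOfRecordSecantEnd.ne5_of_record_secant_actNormDecay` with (i) `hins` := leaf-10's `insertionRate_of_insOp` at the assembly of
record from the DISPLAYED insertion-operator species data (`InsOpEnvelope κ E₀ Gi`, `InsBoundA κ E₀ Gi` — one-run, W2-ins KIND;
`InsOpRate δI θ` — NE2-TYPE; reach `δI·θ^{k₁} ≤ ρ₁ < 1`; `δ′ := Gi·δI∕(1−ρ₁) + 2Gi∕θ^{k₁}`), and (ii) `hΦ` := leaf-02's `anchoredNorm_b13`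
from the DISPLAYED (2.38) SHAPE of the stripped majorant, `actSum (b13InnerData R) (A′ k g U) k Z ≤ ε·e^{−Rt·d(Z)}` on every `R.domAt k`
([Balaban1988RG2Cluster] Lemma 3 (2.38) p. 20 — locator only), with rate room `64·log 162 + 64 ≤ Rt` and smallness `36·Φ₀ < 1`,
`Φ₀ := ε·e^{64}·K₀(64,8)`.  Every other binder of the secant END BY NAME and unchanged: the transport READING; the one-run slice budgets
(W3 KIND); L05∕L06; `RawBounded` ×2 + `WeightedEntrywiseRate c₁ θ^k` + floor `r₀` (W1, row NE2's currency); `OpLipschitz κ Λop ρ₀`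
(W2-op, wall); structure `ActExpLinearOn`, exponent bounds `0 ≤ N ≤ N̄` (units `S.rHist`), absolute majorants `A` with decay split
`A ≤ A′·e^{−κ(d(Z)+5)}` on the budget ball class; radii; signs; numerics (`hreach`, `hB`∕`hfirst`, `hsmall : ω + 2G₁·cA < θ′`,
`G₁ := N̄·Φ₀∕(1−36Φ₀)²`).  Conclusion LITERALLY `NE5 (outA S E₀ cB) (outB S E₀ cB) W κ θ′ C₅`.  NOT a proof of NE5: an implication
from displayed binders. -/
theorem ne5_of_record_secant_shapes {W : Set (ℕ → ℝ)} {ROp RHist : ℕ → ℝ}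
    {N A A' : ℕ → (ℕ → ℝ) → R.carriers.BgB → R.carriers.Dom → InnerLabel R.carriers.Dom (Bnd R) → ℝ}
    {Dt : ActData R.carriers.Dom (InnerLabel R.carriers.Dom (Bnd R)) (OpDatum E) Hist Ω}
    {κ Λop Nbar ε Rt EA₀ E₁ cA c₁ r₀ Gi δI ρ₁ θ θ' ρ₀ B : ℝ} {k₀ k₁ : ℕ} (rI : ℕ → ℝ) (hrI : ∀ k, 0 < rI k)
    (hT : (assembly S).TransportReads W)
    (hbB : (assembly S).SliceBudgetB W κ cB) (hbA : S.D.SliceBudget (step S E₀ cB) W κ cA)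
    (hdA : DecayBound (outA S E₀ cB) W EA₀ κ) (hdB : DecayBound (outB S E₀ cB) W E₀ κ)
    (hRA : RawBounded S.F (assembly S).rawAt W) (hRB : RawBounded S.F S.rawB W)
    (hwer : WeightedEntrywiseRate S.F (assembly S).rawAt S.rawB W c₁ fun k => θ ^ k) (hfl : ∀ k, r₀ ≤ S.rOp k)
    (hienv : (S.D.toInsOpModel (step S E₀ cB) rI hrI).InsOpEnvelope W κ E₀ Gi)
    (hibdA : (S.D.toInsOpModel (step S E₀ cB) rI hrI).InsBoundA W κ E₀ Gi)
    (hirate : (S.D.toInsOpModel (step S E₀ cB) rI hrI).InsOpRate W δI θ) (hδI : 0 ≤ δI) (hGi : 0 ≤ Gi) (hρ₁ : ρ₁ < 1)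
    (hreachI : δI * θ ^ k₁ ≤ ρ₁)
    (hopL : OpLipschitz (step S E₀ cB) W κ Λop ρ₀)
    (hexp : ActExpLinearOn (labelsIndexing (domainGeometry R) (b13InnerData R)) S.act Dt
      (ballClass (selfCtr (assembly S).raw (assembly S).histRef) ROp RHist) W)
    (hN : ActExpNormBound (labelsIndexing (domainGeometry R) (b13InnerData R)) Dt
      (ballClass (selfCtr (assembly S).raw (assembly S).histRef) ROp RHist) W S.rHist N)
    (hN0 : ∀ k g U Z ℓ, 0 ≤ N k g U Z ℓ) (hNle : ∀ k g U Z ℓ, N k g U Z ℓ ≤ Nbar) (hNbar : 0 ≤ Nbar)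
    (habs : ActAbsBound (labelsIndexing (domainGeometry R) (b13InnerData R)) Dt
      (ballClass (selfCtr (assembly S).raw (assembly S).histRef) ROp RHist) W A)
    (hA0 : ∀ k g U Z ℓ, 0 ≤ A k g U Z ℓ) (hA0' : ∀ k g U Z ℓ, 0 ≤ A' k g U Z ℓ) (hκ : 0 ≤ κ)
    (hdec : ∀ k g U Z ℓ, A k g U Z ℓ ≤ A' k g U Z ℓ * Real.exp (-(κ * (R.carriers.d Z + 5))))
    (hε : 0 ≤ ε)
    (h238 : ∀ k, ∀ g ∈ W, ∀ (U : R.carriers.BgB), ∀ Z ∈ R.domAt k,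
      actSum (b13InnerData R) (A' k g U) k Z ≤ ε * Real.exp (-(Rt * R.carriers.d Z)))
    (hRt : 64 * Real.log 162 + 64 ≤ Rt) (hΦsmall : 36 * (ε * Real.exp 64 * B12TreeDecay.K₀ (4 * 2 ^ 4) (2 * 4)) < 1)
    (hOp : ∀ k, c₁ / r₀ * S.rOp k ≤ ROp k) (hHist : ∀ k, (assembly S).bHist E₀ cB k ≤ RHist k)
    (hHistA : ∀ k, (Gi * δI / (1 - ρ₁) + 2 * Gi / θ ^ k₁) * S.rHist k + EA₀ * (S.rHist k * (cA / (1 - S.D.ω))) ≤ RHist k)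
    (hEA₀ : 0 ≤ EA₀) (hE₀ : 0 ≤ E₀) (hE₁ : 0 < E₁) (hΛop : 0 ≤ Λop) (hcA : 0 ≤ cA) (hcB : 0 ≤ cB)
    (hc₁ : 0 ≤ c₁) (hr₀ : 0 < r₀) (hθ0 : 0 < θ) (hθθ' : θ ≤ θ') (hθ'1 : θ' ≤ 1) (hω : 0 < S.D.ω)
    (hω1 : S.D.ω < 1) (hreach : c₁ / r₀ * θ ^ k₀ ≤ ρ₀) (hB : 0 ≤ B) (hfirst : ∀ k < k₀, EA₀ + E₀ ≤ B * θ ^ k)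
    (hsmall : S.D.ω + 2 * (Nbar * (ε * Real.exp 64 * B12TreeDecay.K₀ (4 * 2 ^ 4) (2 * 4) /
      (1 - 36 * (ε * Real.exp 64 * B12TreeDecay.K₀ (4 * 2 ^ 4) (2 * 4))) ^ 2)) * cA < θ') :
    NE5 (outA S E₀ cB) (outB S E₀ cB) W κ θ'
      ((Λop * (c₁ / r₀) + 2 * (Nbar * (ε * Real.exp 64 * B12TreeDecay.K₀ (4 * 2 ^ 4) (2 * 4) /
          (1 - 36 * (ε * Real.exp 64 * B12TreeDecay.K₀ (4 * 2 ^ 4) (2 * 4))) ^ 2)) *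
          (Gi * δI / (1 - ρ₁) + 2 * Gi / θ ^ k₁) + B) * (θ' - S.D.ω) /
        (θ' - (S.D.ω + 2 * (Nbar * (ε * Real.exp 64 * B12TreeDecay.K₀ (4 * 2 ^ 4) (2 * 4) /
          (1 - 36 * (ε * Real.exp 64 * B12TreeDecay.K₀ (4 * 2 ^ 4) (2 * 4))) ^ 2)) * cA))) :=
  ne5_of_record_secant_actNormDecay S E₀ cB hT hbB hbA hdA hdB hRA hRB hwer hfl
    (insertionRate_of_insOp (assembly S) ((assembly S).bHist E₀ cB) rI hrI hienv hibdA hirate hδI hθ0 (hθθ'.trans hθ'1) hρ₁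
      hreachI)
    hopL hexp hN hN0 hNle hNbar habs hA0 hA0' hκ hdec (phi_nonneg hε) hΦsmall
    (fun k g hg U q => anchoredNorm_b13 R hε (h238 k g hg U) hRt q)
    hOp hHist hHistA hEA₀ hE₀ hE₁ hΛop hcA hcB hc₁ hr₀ (deltaIns_nonneg hGi hδI hθ0 hρ₁) hθ0.le hθθ' hθ'1 hω hω1 hreach hB
    hfirst hsmall

/-! ## §2 Leaf L10's letters `k₀`, `B` ELIMINATED -/

/-- [folklore] **THE SAME WITHOUT THE L10 LETTERS**: with `0 < θ < 1` and `0 < ρ₀` the operator reach scale `k₀` and the first-scales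
constant `B` EXIST (leaf-10's `OutputRateArithmetic.reach_scale_exists`, `OutputRateResidual.first_scales_const`), `E₁ := 1`, so §1
gives `∃ C₅, NE5 (outA S E₀ cB) (outB S E₀ cB) W κ θ′ C₅` from the remaining displayed binders (`k₁`, `ρ₁` stay: the history radius
names `δ′`). -/
theorem exists_ne5_of_record_secant_shapes {W : Set (ℕ → ℝ)} {ROp RHist : ℕ → ℝ}
    {N A A' : ℕ → (ℕ → ℝ) → R.carriers.BgB → R.carriers.Dom → InnerLabel R.carriers.Dom (Bnd R) → ℝ}
    {Dt : ActData R.carriers.Dom (InnerLabel R.carriers.Dom (Bnd R)) (OpDatum E) Hist Ω}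
    {κ Λop Nbar ε Rt EA₀ cA c₁ r₀ Gi δI ρ₁ θ θ' ρ₀ : ℝ} {k₁ : ℕ} (rI : ℕ → ℝ) (hrI : ∀ k, 0 < rI k)
    (hT : (assembly S).TransportReads W)
    (hbB : (assembly S).SliceBudgetB W κ cB) (hbA : S.D.SliceBudget (step S E₀ cB) W κ cA)
    (hdA : DecayBound (outA S E₀ cB) W EA₀ κ) (hdB : DecayBound (outB S E₀ cB) W E₀ κ)
    (hRA : RawBounded S.F (assembly S).rawAt W) (hRB : RawBounded S.F S.rawB W)
    (hwer : WeightedEntrywiseRate S.F (assembly S).rawAt S.rawB W c₁ fun k => θ ^ k) (hfl : ∀ k, r₀ ≤ S.rOp k)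
    (hienv : (S.D.toInsOpModel (step S E₀ cB) rI hrI).InsOpEnvelope W κ E₀ Gi)
    (hibdA : (S.D.toInsOpModel (step S E₀ cB) rI hrI).InsBoundA W κ E₀ Gi)
    (hirate : (S.D.toInsOpModel (step S E₀ cB) rI hrI).InsOpRate W δI θ) (hδI : 0 ≤ δI) (hGi : 0 ≤ Gi) (hρ₁ : ρ₁ < 1)
    (hreachI : δI * θ ^ k₁ ≤ ρ₁)
    (hopL : OpLipschitz (step S E₀ cB) W κ Λop ρ₀)
    (hexp : ActExpLinearOn (labelsIndexing (domainGeometry R) (b13InnerData R)) S.act Dt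
      (ballClass (selfCtr (assembly S).raw (assembly S).histRef) ROp RHist) W)
    (hN : ActExpNormBound (labelsIndexing (domainGeometry R) (b13InnerData R)) Dt
      (ballClass (selfCtr (assembly S).raw (assembly S).histRef) ROp RHist) W S.rHist N)
    (hN0 : ∀ k g U Z ℓ, 0 ≤ N k g U Z ℓ) (hNle : ∀ k g U Z ℓ, N k g U Z ℓ ≤ Nbar) (hNbar : 0 ≤ Nbar)
    (habs : ActAbsBound (labelsIndexing (domainGeometry R) (b13InnerData R)) Dt
      (ballClass (selfCtr (assembly S).raw (assembly S).histRef) ROp RHist) W A)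
    (hA0 : ∀ k g U Z ℓ, 0 ≤ A k g U Z ℓ) (hA0' : ∀ k g U Z ℓ, 0 ≤ A' k g U Z ℓ) (hκ : 0 ≤ κ)
    (hdec : ∀ k g U Z ℓ, A k g U Z ℓ ≤ A' k g U Z ℓ * Real.exp (-(κ * (R.carriers.d Z + 5))))
    (hε : 0 ≤ ε)
    (h238 : ∀ k, ∀ g ∈ W, ∀ (U : R.carriers.BgB), ∀ Z ∈ R.domAt k,
      actSum (b13InnerData R) (A' k g U) k Z ≤ ε * Real.exp (-(Rt * R.carriers.d Z)))
    (hRt : 64 * Real.log 162 + 64 ≤ Rt) (hΦsmall : 36 * (ε * Real.exp 64 * B12TreeDecay.K₀ (4 * 2 ^ 4) (2 * 4)) < 1)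
    (hOp : ∀ k, c₁ / r₀ * S.rOp k ≤ ROp k) (hHist : ∀ k, (assembly S).bHist E₀ cB k ≤ RHist k)
    (hHistA : ∀ k, (Gi * δI / (1 - ρ₁) + 2 * Gi / θ ^ k₁) * S.rHist k + EA₀ * (S.rHist k * (cA / (1 - S.D.ω))) ≤ RHist k)
    (hEA₀ : 0 ≤ EA₀) (hE₀ : 0 ≤ E₀) (hΛop : 0 ≤ Λop) (hcA : 0 ≤ cA) (hcB : 0 ≤ cB)
    (hc₁ : 0 ≤ c₁) (hr₀ : 0 < r₀) (hθ0 : 0 < θ) (hθ1 : θ < 1) (hθθ' : θ ≤ θ') (hθ'1 : θ' ≤ 1) (hω : 0 < S.D.ω)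
    (hω1 : S.D.ω < 1) (hρ₀ : 0 < ρ₀)
    (hsmall : S.D.ω + 2 * (Nbar * (ε * Real.exp 64 * B12TreeDecay.K₀ (4 * 2 ^ 4) (2 * 4) /
      (1 - 36 * (ε * Real.exp 64 * B12TreeDecay.K₀ (4 * 2 ^ 4) (2 * 4))) ^ 2)) * cA < θ') :
    ∃ C₅, NE5 (outA S E₀ cB) (outB S E₀ cB) W κ θ' C₅ := by
  obtain ⟨k₀, hk₀⟩ := OutputRateArithmetic.reach_scale_exists (D := c₁ / r₀) (h := 0) (div_nonneg hc₁ hr₀.le) hθ1 hρ₀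
  rw [add_zero] at hk₀
  exact ⟨_, ne5_of_record_secant_shapes S E₀ cB rI hrI hT hbB hbA hdA hdB hRA hRB hwer hfl hienv hibdA hirate hδI hGi hρ₁ hreachI
    hopL hexp hN hN0 hNle hNbar habs hA0 hA0' hκ hdec hε h238 hRt hΦsmall hOp hHist hHistA hEA₀ hE₀ (one_pos : (0 : ℝ) < 1) hΛop
    hcA hcB hc₁ hr₀ hθ0 hθθ' hθ'1 hω hω1 hk₀ (le_max_left 0 ((EA₀ + E₀) / θ ^ k₀))
    (fun k hk => OutputRateResidual.first_scales_const hθ0 hθ1.le hk.le) hsmall⟩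

/-! ## §3 The same for the slot package READ AT THE TRANSPORTED BACKGROUND — the reading `hT` GONE (leaf-03's `readAtSlots`) -/

/-- [folklore] **THE SECANT END IN PRINTED-SHAPE CURRENCIES, READING BY CONSTRUCTION**: §1 for `readAtSlots S ι` (run A's
insertion-operator datum `ι` read AT `R.carriers.transport U`, rule R4), `hT := transportReads_record_readAt S ι W` — no reading
hypothesis remains.  Conclusion LITERALLY `NE5 (outA (readAtSlots S ι) E₀ cB) (outB (readAtSlots S ι) E₀ cB) W κ θ′ C₅`. -/
theorem ne5_of_record_secant_shapes_readAt (ι : (ℕ → ℝ) → R.carriers.BgA → ℕ → IOp) {W : Set (ℕ → ℝ)} {ROp RHist : ℕ → ℝ}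
    {N A A' : ℕ → (ℕ → ℝ) → R.carriers.BgB → R.carriers.Dom → InnerLabel R.carriers.Dom (Bnd R) → ℝ}
    {Dt : ActData R.carriers.Dom (InnerLabel R.carriers.Dom (Bnd R)) (OpDatum E) Hist Ω}
    {κ Λop Nbar ε Rt EA₀ E₁ cA c₁ r₀ Gi δI ρ₁ θ θ' ρ₀ B : ℝ} {k₀ k₁ : ℕ} (rI : ℕ → ℝ) (hrI : ∀ k, 0 < rI k)
    (hbB : (assembly (readAtSlots S ι)).SliceBudgetB W κ cB)
    (hbA : (readAtSlots S ι).D.SliceBudget (step (readAtSlots S ι) E₀ cB) W κ cA)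
    (hdA : DecayBound (outA (readAtSlots S ι) E₀ cB) W EA₀ κ) (hdB : DecayBound (outB (readAtSlots S ι) E₀ cB) W E₀ κ)
    (hRA : RawBounded S.F (assembly (readAtSlots S ι)).rawAt W) (hRB : RawBounded S.F S.rawB W)
    (hwer : WeightedEntrywiseRate S.F (assembly (readAtSlots S ι)).rawAt S.rawB W c₁ fun k => θ ^ k) (hfl : ∀ k, r₀ ≤ S.rOp k)
    (hienv : ((readAtSlots S ι).D.toInsOpModel (step (readAtSlots S ι) E₀ cB) rI hrI).InsOpEnvelope W κ E₀ Gi)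
    (hibdA : ((readAtSlots S ι).D.toInsOpModel (step (readAtSlots S ι) E₀ cB) rI hrI).InsBoundA W κ E₀ Gi)
    (hirate : ((readAtSlots S ι).D.toInsOpModel (step (readAtSlots S ι) E₀ cB) rI hrI).InsOpRate W δI θ) (hδI : 0 ≤ δI)
    (hGi : 0 ≤ Gi) (hρ₁ : ρ₁ < 1) (hreachI : δI * θ ^ k₁ ≤ ρ₁)
    (hopL : OpLipschitz (step (readAtSlots S ι) E₀ cB) W κ Λop ρ₀)
    (hexp : ActExpLinearOn (labelsIndexing (domainGeometry R) (b13InnerData R)) S.act Dt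
      (ballClass (selfCtr (assembly (readAtSlots S ι)).raw (assembly (readAtSlots S ι)).histRef) ROp RHist) W)
    (hN : ActExpNormBound (labelsIndexing (domainGeometry R) (b13InnerData R)) Dt
      (ballClass (selfCtr (assembly (readAtSlots S ι)).raw (assembly (readAtSlots S ι)).histRef) ROp RHist) W S.rHist N)
    (hN0 : ∀ k g U Z ℓ, 0 ≤ N k g U Z ℓ) (hNle : ∀ k g U Z ℓ, N k g U Z ℓ ≤ Nbar) (hNbar : 0 ≤ Nbar)
    (habs : ActAbsBound (labelsIndexing (domainGeometry R) (b13InnerData R)) Dt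
      (ballClass (selfCtr (assembly (readAtSlots S ι)).raw (assembly (readAtSlots S ι)).histRef) ROp RHist) W A)
    (hA0 : ∀ k g U Z ℓ, 0 ≤ A k g U Z ℓ) (hA0' : ∀ k g U Z ℓ, 0 ≤ A' k g U Z ℓ) (hκ : 0 ≤ κ)
    (hdec : ∀ k g U Z ℓ, A k g U Z ℓ ≤ A' k g U Z ℓ * Real.exp (-(κ * (R.carriers.d Z + 5))))
    (hε : 0 ≤ ε)
    (h238 : ∀ k, ∀ g ∈ W, ∀ (U : R.carriers.BgB), ∀ Z ∈ R.domAt k,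
      actSum (b13InnerData R) (A' k g U) k Z ≤ ε * Real.exp (-(Rt * R.carriers.d Z)))
    (hRt : 64 * Real.log 162 + 64 ≤ Rt) (hΦsmall : 36 * (ε * Real.exp 64 * B12TreeDecay.K₀ (4 * 2 ^ 4) (2 * 4)) < 1)
    (hOp : ∀ k, c₁ / r₀ * S.rOp k ≤ ROp k) (hHist : ∀ k, (assembly S).bHist E₀ cB k ≤ RHist k)
    (hHistA : ∀ k, (Gi * δI / (1 - ρ₁) + 2 * Gi / θ ^ k₁) * S.rHist k + EA₀ * (S.rHist k * (cA / (1 - S.D.ω))) ≤ RHist k)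
    (hEA₀ : 0 ≤ EA₀) (hE₀ : 0 ≤ E₀) (hE₁ : 0 < E₁) (hΛop : 0 ≤ Λop) (hcA : 0 ≤ cA) (hcB : 0 ≤ cB)
    (hc₁ : 0 ≤ c₁) (hr₀ : 0 < r₀) (hθ0 : 0 < θ) (hθθ' : θ ≤ θ') (hθ'1 : θ' ≤ 1) (hω : 0 < S.D.ω)
    (hω1 : S.D.ω < 1) (hreach : c₁ / r₀ * θ ^ k₀ ≤ ρ₀) (hB : 0 ≤ B) (hfirst : ∀ k < k₀, EA₀ + E₀ ≤ B * θ ^ k)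
    (hsmall : S.D.ω + 2 * (Nbar * (ε * Real.exp 64 * B12TreeDecay.K₀ (4 * 2 ^ 4) (2 * 4) /
      (1 - 36 * (ε * Real.exp 64 * B12TreeDecay.K₀ (4 * 2 ^ 4) (2 * 4))) ^ 2)) * cA < θ') :
    NE5 (outA (readAtSlots S ι) E₀ cB) (outB (readAtSlots S ι) E₀ cB) W κ θ'
      ((Λop * (c₁ / r₀) + 2 * (Nbar * (ε * Real.exp 64 * B12TreeDecay.K₀ (4 * 2 ^ 4) (2 * 4) /
          (1 - 36 * (ε * Real.exp 64 * B12TreeDecay.K₀ (4 * 2 ^ 4) (2 * 4))) ^ 2)) *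
          (Gi * δI / (1 - ρ₁) + 2 * Gi / θ ^ k₁) + B) * (θ' - S.D.ω) /
        (θ' - (S.D.ω + 2 * (Nbar * (ε * Real.exp 64 * B12TreeDecay.K₀ (4 * 2 ^ 4) (2 * 4) /
          (1 - 36 * (ε * Real.exp 64 * B12TreeDecay.K₀ (4 * 2 ^ 4) (2 * 4))) ^ 2)) * cA))) :=
  ne5_of_record_secant_shapes (readAtSlots S ι) E₀ cB rI hrI (transportReads_record_readAt S ι W) hbB hbA hdA hdB hRA hRB hwer
    hfl hienv hibdA hirate hδI hGi hρ₁ hreachI hopL hexp hN hN0 hNle hNbar habs hA0 hA0' hκ hdec hε h238 hRt hΦsmall hOp hHist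
    hHistA hEA₀ hE₀ hE₁ hΛop hcA hcB hc₁ hr₀ hθ0 hθθ' hθ'1 hω hω1 hreach hB hfirst hsmall

/-- [folklore] **THE MOST REDUCED SECANT FACE OF RECORD**: §2 for `readAtSlots S ι` — reading by construction, `k₀`, `B` eliminated:
`∃ C₅, NE5 (outA (readAtSlots S ι) E₀ cB) (outB (readAtSlots S ι) E₀ cB) W κ θ′ C₅`. -/
theorem exists_ne5_of_record_secant_shapes_readAt (ι : (ℕ → ℝ) → R.carriers.BgA → ℕ → IOp) {W : Set (ℕ → ℝ)}
    {ROp RHist : ℕ → ℝ} {N A A' : ℕ → (ℕ → ℝ) → R.carriers.BgB → R.carriers.Dom → InnerLabel R.carriers.Dom (Bnd R) → ℝ}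
    {Dt : ActData R.carriers.Dom (InnerLabel R.carriers.Dom (Bnd R)) (OpDatum E) Hist Ω}
    {κ Λop Nbar ε Rt EA₀ cA c₁ r₀ Gi δI ρ₁ θ θ' ρ₀ : ℝ} {k₁ : ℕ} (rI : ℕ → ℝ) (hrI : ∀ k, 0 < rI k)
    (hbB : (assembly (readAtSlots S ι)).SliceBudgetB W κ cB)
    (hbA : (readAtSlots S ι).D.SliceBudget (step (readAtSlots S ι) E₀ cB) W κ cA)
    (hdA : DecayBound (outA (readAtSlots S ι) E₀ cB) W EA₀ κ) (hdB : DecayBound (outB (readAtSlots S ι) E₀ cB) W E₀ κ)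
    (hRA : RawBounded S.F (assembly (readAtSlots S ι)).rawAt W) (hRB : RawBounded S.F S.rawB W)
    (hwer : WeightedEntrywiseRate S.F (assembly (readAtSlots S ι)).rawAt S.rawB W c₁ fun k => θ ^ k) (hfl : ∀ k, r₀ ≤ S.rOp k)
    (hienv : ((readAtSlots S ι).D.toInsOpModel (step (readAtSlots S ι) E₀ cB) rI hrI).InsOpEnvelope W κ E₀ Gi)
    (hibdA : ((readAtSlots S ι).D.toInsOpModel (step (readAtSlots S ι) E₀ cB) rI hrI).InsBoundA W κ E₀ Gi)
    (hirate : ((readAtSlots S ι).D.toInsOpModel (step (readAtSlots S ι) E₀ cB) rI hrI).InsOpRate W δI θ) (hδI : 0 ≤ δI)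
    (hGi : 0 ≤ Gi) (hρ₁ : ρ₁ < 1) (hreachI : δI * θ ^ k₁ ≤ ρ₁)
    (hopL : OpLipschitz (step (readAtSlots S ι) E₀ cB) W κ Λop ρ₀)
    (hexp : ActExpLinearOn (labelsIndexing (domainGeometry R) (b13InnerData R)) S.act Dt
      (ballClass (selfCtr (assembly (readAtSlots S ι)).raw (assembly (readAtSlots S ι)).histRef) ROp RHist) W)
    (hN : ActExpNormBound (labelsIndexing (domainGeometry R) (b13InnerData R)) Dt
      (ballClass (selfCtr (assembly (readAtSlots S ι)).raw (assembly (readAtSlots S ι)).histRef) ROp RHist) W S.rHist N)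
    (hN0 : ∀ k g U Z ℓ, 0 ≤ N k g U Z ℓ) (hNle : ∀ k g U Z ℓ, N k g U Z ℓ ≤ Nbar) (hNbar : 0 ≤ Nbar)
    (habs : ActAbsBound (labelsIndexing (domainGeometry R) (b13InnerData R)) Dt
      (ballClass (selfCtr (assembly (readAtSlots S ι)).raw (assembly (readAtSlots S ι)).histRef) ROp RHist) W A)
    (hA0 : ∀ k g U Z ℓ, 0 ≤ A k g U Z ℓ) (hA0' : ∀ k g U Z ℓ, 0 ≤ A' k g U Z ℓ) (hκ : 0 ≤ κ)
    (hdec : ∀ k g U Z ℓ, A k g U Z ℓ ≤ A' k g U Z ℓ * Real.exp (-(κ * (R.carriers.d Z + 5))))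
    (hε : 0 ≤ ε)
    (h238 : ∀ k, ∀ g ∈ W, ∀ (U : R.carriers.BgB), ∀ Z ∈ R.domAt k,
      actSum (b13InnerData R) (A' k g U) k Z ≤ ε * Real.exp (-(Rt * R.carriers.d Z)))
    (hRt : 64 * Real.log 162 + 64 ≤ Rt) (hΦsmall : 36 * (ε * Real.exp 64 * B12TreeDecay.K₀ (4 * 2 ^ 4) (2 * 4)) < 1)
    (hOp : ∀ k, c₁ / r₀ * S.rOp k ≤ ROp k) (hHist : ∀ k, (assembly S).bHist E₀ cB k ≤ RHist k)
    (hHistA : ∀ k, (Gi * δI / (1 - ρ₁) + 2 * Gi / θ ^ k₁) * S.rHist k + EA₀ * (S.rHist k * (cA / (1 - S.D.ω))) ≤ RHist k)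
    (hEA₀ : 0 ≤ EA₀) (hE₀ : 0 ≤ E₀) (hΛop : 0 ≤ Λop) (hcA : 0 ≤ cA) (hcB : 0 ≤ cB)
    (hc₁ : 0 ≤ c₁) (hr₀ : 0 < r₀) (hθ0 : 0 < θ) (hθ1 : θ < 1) (hθθ' : θ ≤ θ') (hθ'1 : θ' ≤ 1) (hω : 0 < S.D.ω)
    (hω1 : S.D.ω < 1) (hρ₀ : 0 < ρ₀)
    (hsmall : S.D.ω + 2 * (Nbar * (ε * Real.exp 64 * B12TreeDecay.K₀ (4 * 2 ^ 4) (2 * 4) /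
      (1 - 36 * (ε * Real.exp 64 * B12TreeDecay.K₀ (4 * 2 ^ 4) (2 * 4))) ^ 2)) * cA < θ') :
    ∃ C₅, NE5 (outA (readAtSlots S ι) E₀ cB) (outB (readAtSlots S ι) E₀ cB) W κ θ' C₅ :=
  exists_ne5_of_record_secant_shapes (readAtSlots S ι) E₀ cB rI hrI (transportReads_record_readAt S ι W) hbB hbA hdA hdB hRA hRB
    hwer hfl hienv hibdA hirate hδI hGi hρ₁ hreachI hopL hexp hN hN0 hNle hNbar habs hA0 hA0' hκ hdec hε h238 hRt hΦsmall hOp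
    hHist hHistA hEA₀ hE₀ hΛop hcA hcB hc₁ hr₀ hθ0 hθ1 hθθ' hθ'1 hω hω1 hρ₀ hsmall

end Summit.QuantumFields.BalabanUV.T4Continuum.B13StepOfRecordSecantShapes

end
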